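import Mathlib
import Literature.NumberTheory.LFunctions.Zhang2022.Section16BlockAClosers
import Literature.NumberTheory.LFunctions.Zhang2022.TypedSection16BLocalEps
import Literature.NumberTheory.LFunctions.Zhang2022.Section16Eq1616R2Plug
import HarnessLib

/-!
# Zhang (2022) §16 (16.15): the Block A plug with `u031` and the weight sum DISCHARGED —
# `Eq16_15E e1pp c′ ⇐ Step16_u037RLE e1pp c′` and `Eq16_15 c′ ⇐ Step16_u037RL c′`

Topic `Literature/NumberTheory/LFunctions/Zhang2022` (Landau–Siegel audit tree; verdict-neutral).
Y. Zhang, *Discrete mean estimates and the Landau–Siegel zero*, arXiv:2211.02515v1 (2022)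
[Zhang2022LandauSiegel] — **an unrefereed manuscript under adjudication**; nothing here bears on its
Theorems 1–2. ZHANG-L discharge lane (WP16, seat zl-w16-p4). The (16.15) edge of record
`eq16_15E_of_repairLε (e1pp) (c') : Step16_u031Lε c' → Step16_u037RLE e1pp c' →
Inline16_varpi2WeightSum c' → Eq16_15E e1pp c'` (zl-w16-typer, `TypedSection16BLocalEps`) with the two
inputs this seat closed (`step16_u031Lε_holds`, `inline16_varpi2WeightSum_holds`): the leaf-level
binder `h15` of `h16_16` is thereby reduced to the single Block A assembly node `Step16_u037RL(E)`.
Theorems only.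

## References

* Y. Zhang, arXiv:2211.02515v1 (2022), §16 (16.15) p. 94, tex L4634. [cite: Zhang2022LandauSiegel, §16 (16.15) p.94]
-/

noncomputable section

open Literature.NumberTheory.LFunctions.Zhang2022
open Literature.NumberTheory.LFunctions.Zhang2022.Skeleton

namespace Literature.NumberTheory.LFunctions.Zhang2022.Typed.Section16B

/-- **`Eq16_15E e1pp c′` from `Step16_u037RLE e1pp c′` alone** (u031Lε and the weight sum are
theorems). [cite: Zhang2022LandauSiegel, §16 (16.15) p.94] -/
theorem eq16_15E_of_u037RLE (e1pp : ℕ → ℂ) (c' : ℝ) (h37 : Step16_u037RLE e1pp c') :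
    Eq16_15E e1pp c' :=
  eq16_15E_of_repairLε e1pp c' (step16_u031Lε_holds c') h37 (inline16_varpi2WeightSum_holds c')

/-- **`Eq16_15 c′` from `Step16_u037RL c′` alone** (printed constant).
[cite: Zhang2022LandauSiegel, §16 (16.15) p.94] -/
theorem eq16_15_of_u037RL (c' : ℝ) (h37 : Step16_u037RL c') : Eq16_15 c' :=
  eq16_15_of_repairLε c' (step16_u031Lε_holds c') h37 (inline16_varpi2WeightSum_holds c')

/-- **`Eq16_16R2E e1pp c′` from `Step16_u037RLE e1pp c′`, `Step16_u041aR c′`, `Lemma162Rq c′`** — the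
whole `h16_16` binder modulo the three remaining block outputs (A: u037RL(E), C: u041aR, D: Lemma162Rq).
[cite: Zhang2022LandauSiegel, §16 (16.16) p.94] -/
theorem eq16_16R2E_of_u037RLE_u041aR_lemma162Rq (e1pp : ℕ → ℂ) (c' : ℝ)
    (h37 : Step16_u037RLE e1pp c') (h41a : Step16_u041aR c') (h162 : Lemma162Rq c') :
    Eq16_16R2E e1pp c' :=
  eq16_16R2E_of_h15_h41a_h162 e1pp c' (eq16_15E_of_u037RLE e1pp c' h37) h41a h162

end Literature.NumberTheory.LFunctions.Zhang2022.Typed.Section16B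

end
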